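import Summits.RiemannHypothesis.RiemannHypothesis.Theorems.SoloInformedGroundStatePoisson
import Mathlib.Analysis.SpecialFunctions.SmoothTransition
import Mathlib.MeasureTheory.Function.JacobianOneDim
import Mathlib.NumberTheory.LSeries.HurwitzZetaValues

/-!
# Ground-state endgame, IX: the window test function

Solo programme `solo-RiemannHypothesis-informed`, session 2. From the windowed E-map image
`E = eMapFn h λ` (part VII) we cut away the tail near `u = 0` with a smooth cutoff `χ_λ`
(`= 0` on `u ≤ 1/(λ+1)`, `= 1` on `u ≥ 2/(λ+1)`), set `G = χ_λ E`, `F = (1 - χ_λ) E`, and pull `G`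
back to the additive line: `g_λ(t) = e^{t/2} G(e^t)`. Then

* `g_λ` is continuous with support in `[-log(λ+1), log(λ+1)]`;
* `ĝ_λ(s) = 𝓜G(s)` (the Weil–Mellin transform is the Mellin transform of `G`);
* at every non-trivial zero `ĝ_λ(ρ) = -𝓜F(ρ)`, and the Poisson bound makes this `O_α(λ^{1-α})`
  for EVERY `α > 1`, uniformly over all the zeros (`norm_weilMellin_winTest_le`);
* at `s = 2`, `|ĝ_λ(2)| ≥ (π²/6)|𝓜h(2)| λ² − O(1)` (`norm_weilMellin_winTest_two_ge`).
-/

noncomputable section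

open Complex Filter Set Topology MeasureTheory Asymptotics
open Literature.NumberTheory.LFunctions

namespace Summit.RiemannHypothesis.RiemannHypothesis.Theorems

/-! ## The cutoff -/

/-- The smooth cutoff `χ_λ(u) = smoothTransition((λ+1)u − 1)`. -/
def emapCutoff (lam u : ℝ) : ℝ := Real.smoothTransition ((lam + 1) * u - 1)

/-- `χ_λ = 0` on `(λ+1)u ≤ 1`. -/
theorem emapCutoff_eq_zero {lam u : ℝ} (hu : (lam + 1) * u ≤ 1) : emapCutoff lam u = 0 :=
  Real.smoothTransition.zero_of_nonpos (by linarith)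

/-- `χ_λ = 1` on `2 ≤ (λ+1)u`. -/
theorem emapCutoff_eq_one {lam u : ℝ} (hu : 2 ≤ (lam + 1) * u) : emapCutoff lam u = 1 :=
  Real.smoothTransition.one_of_one_le (by linarith)

/-- `0 ≤ χ_λ`. -/
theorem emapCutoff_nonneg (lam u : ℝ) : 0 ≤ emapCutoff lam u := Real.smoothTransition.nonneg _

/-- `χ_λ ≤ 1`. -/
theorem emapCutoff_le_one (lam u : ℝ) : emapCutoff lam u ≤ 1 := Real.smoothTransition.le_one _

/-- Continuity of `χ_λ`. -/
theorem continuous_emapCutoff (lam : ℝ) : Continuous (emapCutoff lam) :=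
  Real.smoothTransition.continuous.comp ((continuous_const.mul continuous_id).sub continuous_const)

/-! ## Window part and tail part of the E-map image -/

/-- The window part `G = χ_λ E`. -/
def winFn (h : SchwartzMap ℝ ℂ) (lam : ℝ) (u : ℝ) : ℂ := (emapCutoff lam u : ℂ) * eMapFn h lam u

/-- The tail part `F = (1 - χ_λ) E`. -/
def tailFn (h : SchwartzMap ℝ ℂ) (lam : ℝ) (u : ℝ) : ℂ :=
  ((1 - emapCutoff lam u : ℝ) : ℂ) * eMapFn h lam u

/-- `E = G + F`. -/
theorem eMapFn_eq_winFn_add_tailFn (h : SchwartzMap ℝ ℂ) (lam u : ℝ) :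
    eMapFn h lam u = winFn h lam u + tailFn h lam u := by
  unfold winFn tailFn
  push_cast
  ring

/-- `‖G‖ ≤ ‖E‖`. -/
theorem norm_winFn_le (h : SchwartzMap ℝ ℂ) (lam u : ℝ) : ‖winFn h lam u‖ ≤ ‖eMapFn h lam u‖ := by
  unfold winFn
  rw [norm_mul, Complex.norm_real, Real.norm_of_nonneg (emapCutoff_nonneg lam u)]
  exact (mul_le_of_le_one_left (norm_nonneg _) (emapCutoff_le_one lam u))

/-- `‖F‖ ≤ ‖E‖`. -/
theorem norm_tailFn_le (h : SchwartzMap ℝ ℂ) (lam u : ℝ) :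
    ‖tailFn h lam u‖ ≤ ‖eMapFn h lam u‖ := by
  unfold tailFn
  rw [norm_mul, Complex.norm_real,
    Real.norm_of_nonneg (by linarith [emapCutoff_le_one lam u] : (0 : ℝ) ≤ 1 - emapCutoff lam u)]
  exact mul_le_of_le_one_left (norm_nonneg _) (by linarith [emapCutoff_nonneg lam u])

/-- `G = 0` on `(λ+1)u ≤ 1`. -/
theorem winFn_eq_zero_of_le (h : SchwartzMap ℝ ℂ) {lam u : ℝ} (hu : (lam + 1) * u ≤ 1) :
    winFn h lam u = 0 := by
  unfold winFn
  rw [emapCutoff_eq_zero hu, Complex.ofReal_zero, zero_mul]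

/-- `F = 0` on `2 ≤ (λ+1)u`. -/
theorem tailFn_eq_zero_of_le (h : SchwartzMap ℝ ℂ) {lam u : ℝ} (hu : 2 ≤ (lam + 1) * u) :
    tailFn h lam u = 0 := by
  unfold tailFn
  rw [emapCutoff_eq_one hu, sub_self, Complex.ofReal_zero, zero_mul]

/-- `G = 0` on `u ≤ 0`. -/
theorem winFn_of_nonpos (h : SchwartzMap ℝ ℂ) (lam : ℝ) {u : ℝ} (hu : u ≤ 0) : winFn h lam u = 0 := by
  unfold winFn
  rw [eMapFn_of_nonpos h lam hu, mul_zero]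

/-- `F = 0` on `u ≤ 0`. -/
theorem tailFn_of_nonpos (h : SchwartzMap ℝ ℂ) (lam : ℝ) {u : ℝ} (hu : u ≤ 0) :
    tailFn h lam u = 0 := by
  unfold tailFn
  rw [eMapFn_of_nonpos h lam hu, mul_zero]

/-- `G = 0` beyond `λ` for a seed supported in `(-∞, 1]`. -/
theorem winFn_eq_zero_of_lt (h : SchwartzMap ℝ ℂ) (hsupp : ∀ x : ℝ, 1 < x → h x = 0)
    {lam : ℝ} (hlam : 0 < lam) {u : ℝ} (hu : lam < u) : winFn h lam u = 0 := by
  unfold winFn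
  rw [eMapFn_eq_zero_of_lt h hsupp hlam hu, mul_zero]

/-- `F = 0` beyond `λ` for a seed supported in `(-∞, 1]`. -/
theorem tailFn_eq_zero_of_lt (h : SchwartzMap ℝ ℂ) (hsupp : ∀ x : ℝ, 1 < x → h x = 0)
    {lam : ℝ} (hlam : 0 < lam) {u : ℝ} (hu : lam < u) : tailFn h lam u = 0 := by
  unfold tailFn
  rw [eMapFn_eq_zero_of_lt h hsupp hlam hu, mul_zero]

/-- Measurability of `G`. -/
theorem aestronglyMeasurable_winFn (h : SchwartzMap ℝ ℂ) {lam : ℝ} (hlam : 0 < lam) :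
    AEStronglyMeasurable (winFn h lam) volume :=
  (Complex.continuous_ofReal.comp (continuous_emapCutoff lam)).aestronglyMeasurable.mul
    (aestronglyMeasurable_eMapFn h hlam)

/-- Measurability of `F`. -/
theorem aestronglyMeasurable_tailFn (h : SchwartzMap ℝ ℂ) {lam : ℝ} (hlam : 0 < lam) :
    AEStronglyMeasurable (tailFn h lam) volume :=
  (Complex.continuous_ofReal.comp (continuous_const.sub (continuous_emapCutoff lam))).aestronglyMeasurable.mul
    (aestronglyMeasurable_eMapFn h hlam)

section moments

variable (h : SchwartzMap ℝ ℂ) (heven : ∀ x, h (-x) = h x) (h0 : h 0 = 0)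
  (hint : ∫ x : ℝ, h x = 0) (hsupp : ∀ x : ℝ, 1 < x → h x = 0)
include heven h0 hint hsupp

/-- Mellin convergence of `G` on `0 < Re s`. -/
theorem mellinConvergent_winFn {lam : ℝ} (hlam : 0 < lam) {s : ℂ} (hs : 0 < s.re) :
    MellinConvergent (winFn h lam) s := by
  obtain ⟨C, -, hC⟩ := norm_eMapFn_le_const h heven h0 hint hsupp
  refine mellinConvergent_of_bdd_of_eq_zero (U := lam + 1) (aestronglyMeasurable_winFn h hlam)
    (fun u => (norm_winFn_le h lam u).trans (hC lam hlam u)) (fun u hu => ?_) hs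
  rcases le_or_gt u 0 with hu' | hu'
  · exact winFn_of_nonpos h lam hu'
  · have : lam + 1 < u := by
      by_contra hle
      exact hu ⟨hu', not_lt.1 hle⟩
    exact winFn_eq_zero_of_lt h hsupp hlam (by linarith)

/-- Mellin convergence of `F` on `0 < Re s`. -/
theorem mellinConvergent_tailFn {lam : ℝ} (hlam : 0 < lam) {s : ℂ} (hs : 0 < s.re) :
    MellinConvergent (tailFn h lam) s := by
  obtain ⟨C, -, hC⟩ := norm_eMapFn_le_const h heven h0 hint hsupp
  refine mellinConvergent_of_bdd_of_eq_zero (U := lam + 1) (aestronglyMeasurable_tailFn h hlam)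
    (fun u => (norm_tailFn_le h lam u).trans (hC lam hlam u)) (fun u hu => ?_) hs
  rcases le_or_gt u 0 with hu' | hu'
  · exact tailFn_of_nonpos h lam hu'
  · have : lam + 1 < u := by
      by_contra hle
      exact hu ⟨hu', not_lt.1 hle⟩
    exact tailFn_eq_zero_of_lt h hsupp hlam (by linarith)

/-- `𝓜G = 𝓜E − 𝓜F` on `0 < Re s`. -/
theorem mellin_winFn_eq {lam : ℝ} (hlam : 0 < lam) {s : ℂ} (hs : 0 < s.re) :
    mellin (winFn h lam) s = mellin (eMapFn h lam) s - mellin (tailFn h lam) s := by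
  have h1 : MellinConvergent (eMapFn h lam) s := mellinConvergent_eMapFn h heven h0 hint hsupp hlam hs
  have h2 : MellinConvergent (tailFn h lam) s := mellinConvergent_tailFn h heven h0 hint hsupp hlam hs
  unfold mellin
  rw [← integral_sub h1 h2]
  refine setIntegral_congr_fun measurableSet_Ioi fun u _ => ?_
  simp only [eMapFn_eq_winFn_add_tailFn h lam u, smul_eq_mul]
  unfold winFn tailFn
  ring

/-- **`𝓜G(ρ) = −𝓜F(ρ)` at the zeros.** -/
theorem mellin_winFn_eq_neg {lam : ℝ} (hlam : 0 < lam) {ρ : ℂ} (hρ : 0 < ρ.re) (hρ1 : ρ ≠ 1)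
    (hζ : riemannZeta ρ = 0) : mellin (winFn h lam) ρ = -mellin (tailFn h lam) ρ := by
  rw [mellin_winFn_eq h heven h0 hint hsupp hlam hρ,
    mellin_eMapFn_eq_zero_of_riemannZeta_eq_zero h heven h0 hint hsupp hlam hρ hρ1 hζ, zero_sub]

omit hsupp in
/-- **THE TAIL IS MELLIN-SMALL**: `‖𝓜F(s)‖ ≤ C_α λ^{1-α}` for all `λ ≥ 1`, `Re s > 0`, every `α > 1`
(Poisson bound on `(0, 2/(λ+1)]`, where `F` lives). -/
theorem norm_mellin_tailFn_le {α : ℝ} (hα : 1 < α) :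
    ∃ C : ℝ, 0 ≤ C ∧ ∀ lam : ℝ, 1 ≤ lam → ∀ s : ℂ, 0 < s.re →
      ‖mellin (tailFn h lam) s‖ ≤ C * lam ^ (1 - α) := by
  obtain ⟨C, hC0, hC⟩ := norm_eMapFn_le_rpow h heven h0 hint hα
  refine ⟨C / (α - 1), div_nonneg hC0 (by linarith), fun lam hlam s hs => ?_⟩
  have hlam0 : 0 < lam := by linarith
  set U : ℝ := 2 / (lam + 1) with hU
  have hU0 : 0 < U := by positivity
  have hU1 : U ≤ 1 := by rw [hU, div_le_one (by linarith)]; linarith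
  have hM : 0 ≤ C * lam ^ (1 - α) := mul_nonneg hC0 (Real.rpow_nonneg hlam0.le _)
  have hb : ∀ u : ℝ, 0 < u → u ≤ U → ‖tailFn h lam u‖ ≤ C * lam ^ (1 - α) * u ^ (α - 1) := by
    intro u hu _
    calc ‖tailFn h lam u‖ ≤ ‖eMapFn h lam u‖ := norm_tailFn_le h lam u
      _ ≤ C * (lam⁻¹ * u) ^ (α - 1) := hC lam hlam0 u hu
      _ = C * lam ^ (1 - α) * u ^ (α - 1) := by
          rw [Real.mul_rpow (inv_nonneg.2 hlam0.le) hu.le, Real.inv_rpow hlam0.le,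
            ← Real.rpow_neg hlam0.le, neg_sub]
          ring
  have hz : ∀ u : ℝ, U < u → tailFn h lam u = 0 := by
    intro u hu
    refine tailFn_eq_zero_of_le h ?_
    have hUe : (lam + 1) * U = 2 := by rw [hU]; field_simp
    calc (2 : ℝ) = (lam + 1) * U := hUe.symm
      _ ≤ (lam + 1) * u := mul_le_mul_of_nonneg_left hu.le (by linarith)
  have hKs : 0 < α - 1 + s.re := by linarith
  have key := norm_mellin_le_of_pow_decay hU0 (by linarith : (0 : ℝ) ≤ α - 1) hb hz hs
  have hUp : U ^ (α - 1 + s.re) ≤ 1 := Real.rpow_le_one hU0.le hU1 hKs.le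
  calc ‖mellin (tailFn h lam) s‖ ≤ C * lam ^ (1 - α) * U ^ (α - 1 + s.re) / (α - 1 + s.re) := key
    _ ≤ C * lam ^ (1 - α) * 1 / (α - 1) := by
        rw [div_le_div_iff₀ hKs (by linarith)]
        calc C * lam ^ (1 - α) * U ^ (α - 1 + s.re) * (α - 1)
            ≤ C * lam ^ (1 - α) * 1 * (α - 1) :=
              mul_le_mul_of_nonneg_right (mul_le_mul_of_nonneg_left hUp hM) (by linarith)
          _ ≤ C * lam ^ (1 - α) * 1 * (α - 1 + s.re) :=
              mul_le_mul_of_nonneg_left (by linarith) (by rw [mul_one]; exact hM)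
    _ = C / (α - 1) * lam ^ (1 - α) := by ring

end moments

/-! ## The window test function on the additive line -/

/-- `g_λ(t) = e^{t/2} G(e^t)`. -/
def winTest (h : SchwartzMap ℝ ℂ) (lam : ℝ) (t : ℝ) : ℂ :=
  (Real.exp (t / 2) : ℂ) * winFn h lam (Real.exp t)

/-- Continuity of `g_λ`. -/
theorem continuous_winTest (h : SchwartzMap ℝ ℂ) {lam : ℝ} (hlam : 0 < lam) :
    Continuous (winTest h lam) := by
  have h1 : Continuous fun t : ℝ => eMapFn h lam (Real.exp t) :=
    (continuousOn_eMapFn h hlam).comp_continuous Real.continuous_exp fun t => Real.exp_pos t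
  have h2 : Continuous fun t : ℝ => (emapCutoff lam (Real.exp t) : ℂ) :=
    Complex.continuous_ofReal.comp ((continuous_emapCutoff lam).comp Real.continuous_exp)
  have h3 : Continuous fun t : ℝ => (Real.exp (t / 2) : ℂ) :=
    Complex.continuous_ofReal.comp (Real.continuous_exp.comp (continuous_id.div_const 2))
  unfold winTest winFn
  exact h3.mul (h2.mul h1)

/-- `g_λ` vanishes for `|t| > log(λ+1)`. -/
theorem winTest_eq_zero (h : SchwartzMap ℝ ℂ) (hsupp : ∀ x : ℝ, 1 < x → h x = 0)
    {lam : ℝ} (hlam : 0 < lam) {t : ℝ} (ht : Real.log (lam + 1) < |t|) : winTest h lam t = 0 := by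
  unfold winTest
  have hl1 : (0 : ℝ) < lam + 1 := by linarith
  rcases le_or_gt 0 t with h0t | h0t
  · rw [abs_of_nonneg h0t] at ht
    have hlt : lam < Real.exp t := by
      have := Real.exp_lt_exp.2 ht
      rw [Real.exp_log hl1] at this
      linarith
    rw [winFn_eq_zero_of_lt h hsupp hlam hlt, mul_zero]
  · rw [abs_of_neg h0t] at ht
    have hle : (lam + 1) * Real.exp t ≤ 1 := by
      have h1 : Real.exp t < Real.exp (-Real.log (lam + 1)) := Real.exp_lt_exp.2 (by linarith)
      rw [Real.exp_neg, Real.exp_log hl1] at h1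
      have h2 := mul_lt_mul_of_pos_left h1 hl1
      rw [mul_inv_cancel₀ hl1.ne'] at h2
      exact h2.le
    rw [winFn_eq_zero_of_le h hle, mul_zero]

/-- Support of `g_λ`. -/
theorem tsupport_winTest_subset (h : SchwartzMap ℝ ℂ) (hsupp : ∀ x : ℝ, 1 < x → h x = 0)
    {lam : ℝ} (hlam : 0 < lam) :
    tsupport (winTest h lam) ⊆ Icc (-Real.log (lam + 1)) (Real.log (lam + 1)) := by
  refine closure_minimal (fun t ht => ?_) isClosed_Icc
  by_contra habs
  refine ht (winTest_eq_zero h hsupp hlam ?_)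
  rcases le_or_gt 0 t with h0 | h0
  · rw [abs_of_nonneg h0]
    by_contra hle
    exact habs ⟨by linarith [Real.log_nonneg (by linarith : (1 : ℝ) ≤ lam + 1), not_lt.1 hle],
      not_lt.1 hle⟩
  · rw [abs_of_neg h0]
    by_contra hle
    exact habs ⟨by linarith [not_lt.1 hle],
      by linarith [Real.log_nonneg (by linarith : (1 : ℝ) ≤ lam + 1), not_lt.1 hle]⟩

/-- Compact support of `g_λ`. -/
theorem hasCompactSupport_winTest (h : SchwartzMap ℝ ℂ) (hsupp : ∀ x : ℝ, 1 < x → h x = 0)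
    {lam : ℝ} (hlam : 0 < lam) : HasCompactSupport (winTest h lam) :=
  HasCompactSupport.of_support_subset_isCompact isCompact_Icc
    (subset_tsupport _ |>.trans (tsupport_winTest_subset h hsupp hlam))

/-- **`ĝ_λ = 𝓜G`**: the Weil–Mellin transform of `g_λ` is the Mellin transform of `G`
(substitution `u = e^t`). -/
theorem weilMellin_winTest (h : SchwartzMap ℝ ℂ) (lam : ℝ) (s : ℂ) :
    weilMellin (winTest h lam) s = mellin (winFn h lam) s := by
  unfold weilMellin mellin
  have himage : Real.exp '' univ = Ioi (0 : ℝ) := by rw [image_univ, Real.range_exp]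
  rw [← himage, integral_image_eq_integral_abs_deriv_smul MeasurableSet.univ
      (fun x _ => (Real.hasDerivAt_exp x).hasDerivWithinAt) Real.exp_injective.injOn,
    Measure.restrict_univ]
  refine integral_congr_ae (Eventually.of_forall fun t => ?_)
  have hcpow : ((Real.exp t : ℝ) : ℂ) ^ (s - 1) = cexp ((s - 1) * t) := by
    rw [Complex.ofReal_exp, Complex.cpow_def_of_ne_zero (Complex.exp_ne_zero _),
      Complex.log_exp (by rw [Complex.ofReal_im]; linarith [Real.pi_pos])
        (by rw [Complex.ofReal_im]; exact Real.pi_pos.le), mul_comm]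
  simp only [winTest]
  rw [hcpow, Complex.real_smul, smul_eq_mul, abs_of_pos (Real.exp_pos t), Complex.ofReal_exp,
    Complex.ofReal_exp]
  have e1 : cexp (((t / 2 : ℝ)) : ℂ) * cexp ((s - 1 / 2) * (t : ℂ)) = cexp (t : ℂ) * cexp ((s - 1) * (t : ℂ)) := by
    rw [← Complex.exp_add, ← Complex.exp_add]
    congr 1
    push_cast
    ring
  calc cexp ((t / 2 : ℝ) : ℂ) * winFn h lam (Real.exp t) * cexp ((s - 1 / 2) * (t : ℂ))
      = cexp ((t / 2 : ℝ) : ℂ) * cexp ((s - 1 / 2) * (t : ℂ)) * winFn h lam (Real.exp t) := by ring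
    _ = cexp (t : ℂ) * cexp ((s - 1) * (t : ℂ)) * winFn h lam (Real.exp t) := by rw [e1]
    _ = cexp (t : ℂ) * (cexp ((s - 1) * (t : ℂ)) * winFn h lam (Real.exp t)) := by ring

section zeros

variable (h : SchwartzMap ℝ ℂ) (heven : ∀ x, h (-x) = h x) (h0 : h 0 = 0)
  (hint : ∫ x : ℝ, h x = 0) (hsupp : ∀ x : ℝ, 1 < x → h x = 0)
include heven h0 hint hsupp

/-- **THE WINDOW TEST IS SMALL AT EVERY ZERO**: for every `α > 1` there is `C_α` with
`‖ĝ_λ(ρ)‖ ≤ C_α λ^{1-α}` for all `λ ≥ 1` and all non-trivial zeros `ρ` — uniformly in the zero. -/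
theorem norm_weilMellin_winTest_le {α : ℝ} (hα : 1 < α) :
    ∃ C : ℝ, 0 ≤ C ∧ ∀ lam : ℝ, 1 ≤ lam → ∀ ρ ∈ ZetaZeros.riemannZetaNontrivialZeros,
      ‖weilMellin (winTest h lam) ρ‖ ≤ C * lam ^ (1 - α) := by
  obtain ⟨C, hC0, hC⟩ := norm_mellin_tailFn_le h heven h0 hint hα
  refine ⟨C, hC0, fun lam hlam ρ hρ => ?_⟩
  obtain ⟨hζ, hre, hre1⟩ := mem_riemannZetaNontrivialZeros_iff_holds.1 hρ
  have hρ1 : ρ ≠ 1 := by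
    rintro rfl
    simp at hre1
  rw [weilMellin_winTest, mellin_winFn_eq_neg h heven h0 hint hsupp (by linarith) hre hρ1 hζ, norm_neg]
  exact hC lam hlam ρ hre

/-- **THE WINDOW TEST IS LARGE AT `s = 2`**: `‖ĝ_λ(2)‖ ≥ (π²/6) ‖𝓜h(2)‖ λ² − C` for `λ ≥ 1`. -/
theorem norm_weilMellin_winTest_two_ge :
    ∃ C : ℝ, ∀ lam : ℝ, 1 ≤ lam →
      Real.pi ^ 2 / 6 * ‖mellin (fun x : ℝ => h x) 2‖ * lam ^ 2 - C ≤ ‖weilMellin (winTest h lam) 2‖ := by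
  obtain ⟨C, hC0, hC⟩ := norm_mellin_tailFn_le h heven h0 hint one_lt_two
  refine ⟨C, fun lam hlam => ?_⟩
  have hlam0 : 0 < lam := by linarith
  have h2 : 0 < (2 : ℂ).re := by norm_num
  have h2' : 1 < (2 : ℂ).re := by norm_num
  rw [weilMellin_winTest, mellin_winFn_eq h heven h0 hint hsupp hlam0 h2, mellin_eMapFn_eq h hlam0 h2',
    riemannZeta_two]
  set A : ℂ := (lam : ℂ) ^ (2 : ℂ) * ((Real.pi : ℂ) ^ 2 / 6) * mellin (fun x : ℝ => h x) 2
  set B : ℂ := mellin (tailFn h lam) 2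
  have hB : ‖B‖ ≤ C := by
    have := hC lam hlam 2 h2
    have hp : lam ^ ((1 : ℝ) - 2) ≤ 1 :=
      Real.rpow_le_one_of_one_le_of_nonpos hlam (by norm_num)
    calc ‖B‖ ≤ C * lam ^ ((1 : ℝ) - 2) := this
      _ ≤ C * 1 := mul_le_mul_of_nonneg_left hp hC0
      _ = C := mul_one C
  have hA : ‖A‖ = Real.pi ^ 2 / 6 * ‖mellin (fun x : ℝ => h x) 2‖ * lam ^ 2 := by
    have hn : ‖(lam : ℂ) ^ (2 : ℂ)‖ = lam ^ 2 := by
      rw [Complex.norm_cpow_eq_rpow_re_of_pos hlam0, show (2 : ℂ).re = (2 : ℝ) by norm_num,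
        Real.rpow_two]
    have hπ : ‖((Real.pi : ℂ) ^ 2 / 6)‖ = Real.pi ^ 2 / 6 := by
      rw [norm_div, norm_pow, Complex.norm_real, Real.norm_of_nonneg Real.pi_pos.le]
      norm_num
    simp only [A, norm_mul, hn, hπ]
    ring
  calc Real.pi ^ 2 / 6 * ‖mellin (fun x : ℝ => h x) 2‖ * lam ^ 2 - C ≤ ‖A‖ - ‖B‖ := by
        rw [hA]; linarith
    _ ≤ ‖A - B‖ := norm_sub_norm_le A B

end zeros

end Summit.RiemannHypothesis.RiemannHypothesis.Theorems
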